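import Summits.ABC.IUTFork.Joshi.TestGenuinePinsVacuitySqrtThree
import Summits.ABC.IUTFork.Thm311RealIsmDHMoverWildQuadraticDyadic
import Literature.IUT.LogVolume.GenuineSupportPrimesBound
import HarnessLib

/-!
# Branch E TEST — the genuine-carrier pins over a number field `F ≠ ℚ`: ONE kernel residual theorem (R-J row Y-26)

Proof-only sequel (abc-iut cell, D-0079 R-J «Joshi Y-discharge census», row Y-26 residual class; seat abc-iut-E-t43, gen 5; 0 definitions,
no `Prop` fact, FACT rows used: none) to this lineage's `Joshi/TestGenuinePinsVacuity{Residual,Quadratic,Sqrt,SqrtThree}.lean`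
(p461298 / p461750 / p462506 / p488653) and abc-iut-E-t44's `…Vacuity{,Tame,Ramified}.lean` (p445249 / p446217 / p446474).  Those files
feed the Y-26 obstruction of record PLACE BY PLACE («pins KERNEL-EMPTY as soon as ONE completion of `F` lies outside the fixed list
{unramified over odd `p`; `ℚ_2`; the `ℚ_2(√3)`-type; the `ℚ_3(ζ_3)`-type}», p461298's CONSEQUENCE FOR THE RECORD).  THIS FILE turns that
hand sentence into ONE kernel theorem with `F ≠ ℚ` as hypothesis and the two residual ramified local types NAMED INTRINSICALLY:

* §1 **`not_pinnedRegions(3)_settingPrVolSharp_of_wild_quadratic_dyadic_anyPrime`** — the last per-place feed: ONE place `v₀ ∣ 2` with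
  `(e, f) = (2, 1)` whose unit-log lattice is NOT `2𝒪_{v₀}` (`logUnits F_{v₀} ≠ {‖y‖ ≤ ‖2‖}`) ⇒ pins EMPTY.  Engine: abc-iut-w4-d017's
  INTRINSIC TRICHOTOMY of wild quadratic dyadic fields (`Literature/IUT/LogVolume/UnitLogWildQuadraticDyadicCases` §7, classical,
  Neukirch II (5.5)): with `u₀ = 1 − ϖ`, `‖log₂ u₀‖ ∈ {‖ϖ‖, ‖ϖ‖², ≤ ‖ϖ‖³}` and accordingly `log₂(𝒪^×)` is NO `𝒪`-module (every ball is
  moved: `closedBall_ne_zpow_smul_logUnits`), `= 𝔪² = 2𝒪` (the `ℚ_2(√3)`-type — unit ball FIXED, excluded here), or `= 𝔪³` (the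
  `ℚ_2(√−1)`-type — unit ball moved by the PARITY MOVER `exists_mem_ismDH_image_closedBall_ne_of_logUnits_eq_of_not_dvd`, `2 ∤ 0 − 3`).
  No `√a`-presentation of the completion is needed.
* §2 **`not_pinnedRegions(3)_settingPrVolSharp_of_one_lt_finrank`** — for EVERY number field `F` with `1 < [F : ℚ]`: IF no place `v ∣ 3`
  with `(e, f) = (2, 1)` has `ζ_3` in its completion (`torsionPExp 3 F_v = 0`; the `ℚ_3(ζ_3)`-type excluded) AND no place `v ∣ 2` with
  `(e, f) = (2, 1)` has `log₂(𝒪_v^×) = 2𝒪_v` (the `ℚ_2(√3)`-type excluded), THEN the three region pins of [IUTchIII] Cor. 3.12 instantiated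
  on the Dupuy–Hilado carriers FAIL at abc-iut-c312-7's `settingPrVolSharp` — every `X : PilotData F`, `ρ`, `qK`, column data, `Ψ`, ideles,
  column.  Engine: Hermite–Minkowski (`NumberField.abs_discr_gt_two`: `|d_F| > 2`) ⇒ a prime `p ∣ d_F` ⇒ a place `u ∣ p` with `e(u|p) ≥ 2`
  (Dedekind, the tree's `Cor22.exists_ramified_place_of_dvd_discr` over Mathlib's `NumberField.not_dvd_discr_iff_forall_mem`) ⇒ `p ≥ 5`:
  p446474; `p = 3`: p461298's `…_of_three_anyPrime` / `…_of_torsionPExp_eq_zero_anyPrime`; `p = 2`: p461298's `…_of_dyadic_complete_anyPrime`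
  / §1.
* `…_of_one_lt_finrank'` — the same with the `3`-adic exclusion in `√−3`-currency («no `r ∈ F_v` with `r² = −3`»).  COROLLARIES with purely
  global hypotheses (no `(2,1)`-place over `2`, `3`; `2 ∤ d_F ∧ 3 ∤ d_F`; `F/ℚ` Galois of odd degree; a prime `p ≥ 5 ∣ d_F`) are the sequel
  `Joshi/TestGenuinePinsVacuityNeRatCorollaries.lean`.

WHAT STAYS ON PAPER (named precisely, unchanged): «no number field `F ≠ ℚ` has ALL its ramified places of the two residual types» — i.e.
`F ≠ ℚ`, `d_F = ± 2^a 3^b`, every ramified dyadic place of `ℚ_2(√3)`-type and every ramified place over `3` of `ℚ_3(ζ_3)`-type ⇒ on paper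
`rd(F) ≤ 2√3` and the small-degree tables (Hunter 1957 / Pohst 1982 / Diaz y Diaz 1984 / Odlyzko) leave `F ∈ {ℚ(√−1), ℚ(√±2), ℚ(√±3),
ℚ(ζ_12)}`, all killed by p461949 / p488653; so ON PAPER the residual class is `{ℚ}` (E-t41's p463284: pins INHABITED at `F = ℚ`), in KERNEL
it is cut to the hypothesis of §2.  HONEST SCOPE: OUR interface, OUR sharp real container, Dupuy–Hilado's reading of (Ind2); nothing here
bears on print's (xi-e)/(xi-f); locates / conditionally verifies; no abc claim. [claim: Mochizuki2012, status: disputed]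
[cite: DupuyHilado2025, §4.9] [cite: NeukirchANT1999, Ch. II Prop. (5.5), (5.7), Ch. III Thm. (2.12)]
-/

noncomputable section

open Set Function NumberField IsDedekindDomain Metric
open scoped Pointwise

namespace Summit.ABC.IUTFork.Joshi

open Thm311 Thm311.Real Cor312 Cor312Vol Literature.IUT.LogThetaLattice Literature.IUT.LogVolume
  Literature.IUT.HodgeTheaters Literature.NumberTheory.NumberFields
open Literature.NumberTheory.GaloisRepresentations.Ultrametric

/-! ## 0. Classical helpers -/

namespace GenuinePinsResidual

/-- **Hermite–Minkowski + Dedekind: a number field `F ≠ ℚ` has a RAMIFIED finite place** — `|d_F| > 2` (Mathlib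
`NumberField.abs_discr_gt_two`), so a prime `p ∣ d_F`, and a prime dividing the discriminant lies under a place with `e ≥ 2` (the tree's
`Cor22.exists_ramified_place_of_dvd_discr`). [cite: NeukirchANT1999, Ch. III Thm. (2.12), (2.17)] -/
theorem exists_prime_two_le_ramificationIdx_of_one_lt_finrank {F : Type} [Field F] [NumberField F] (hF : 1 < Module.finrank ℚ F) :
    ∃ (p : ℕ) (u : HeightOneSpectrum (𝓞 F)), p.Prime ∧ residueChar F u = p ∧ 2 ≤ u.asIdeal.ramificationIdx ℤ := by
  have hgt : 2 < |NumberField.discr F| := NumberField.abs_discr_gt_two hF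
  have hne1 : (NumberField.discr F).natAbs ≠ 1 := by
    intro h1
    have h := Int.natAbs_eq (NumberField.discr F)
    rw [h1] at h
    rcases h with h | h <;> rw [h] at hgt <;> norm_num at hgt
  obtain ⟨p, hp, hpd⟩ := Nat.exists_prime_and_dvd hne1
  obtain ⟨u, hu, he⟩ := Cor22.exists_ramified_place_of_dvd_discr F hp (Int.natCast_dvd.mpr hpd)
  exact ⟨p, u, hp, hu, he⟩

/-- In a field, a non-trivial `3`-power root of unity yields `r` with `r² = −3` (`r = 2μ + 1` for a primitive cube root `μ`).
[cite: NeukirchANT1999, Ch. II Prop. (5.7)] -/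
theorem exists_sq_eq_neg_three_of_torsionPExp_ne_zero (K : Type*) [NontriviallyNormedField K] [NormedAlgebra ℚ_[3] K]
    [IsUltrametricDist K] [ProperSpace K] [Fact (Nat.Prime 3)] (hm : torsionPExp 3 K ≠ 0) : ∃ r : K, r ^ 2 = -3 := by
  have hm1 : 1 ≤ torsionPExp 3 K := Nat.pos_of_ne_zero hm
  obtain ⟨ζ, hζ⟩ := exists_isPrimitiveRoot_pow_torsionPExp 3 K
  have hpow : 3 ^ torsionPExp 3 K = 3 ^ (torsionPExp 3 K - 1) * 3 := by
    rw [← pow_succ, Nat.sub_add_cancel hm1]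
  have hζ3 : IsPrimitiveRoot (ζ ^ 3 ^ (torsionPExp 3 K - 1)) 3 := hζ.pow (pow_pos (by norm_num) _) hpow
  set μ : K := ζ ^ 3 ^ (torsionPExp 3 K - 1)
  have hμ1 : μ ≠ 1 := hζ3.ne_one (by norm_num)
  have hμ3 : μ ^ 3 = 1 := hζ3.pow_eq_one
  have hcyc : μ ^ 2 + μ + 1 = 0 := by
    have h0 : (μ - 1) * (μ ^ 2 + μ + 1) = 0 := by linear_combination hμ3
    rcases mul_eq_zero.mp h0 with h | h
    · exact absurd (sub_eq_zero.mp h) hμ1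
    · exact h
  exact ⟨2 * μ + 1, by linear_combination (4 : K) * hcyc⟩

end GenuinePinsResidual

open GenuinePinsResidual

variable {F : Type} [Field F] [NumberField F] (X : PilotData F)
  (M : Type) [Field M] [NumberField M]
  (archPk : ∀ (j : (thetaIndex X).Label) (vQ : (thetaIndex X).VQ), Set ((logShellsDH X (analyticLogv F)).Packet j vQ))
  (archSub : ∀ (j : (thetaIndex X).Label) (v : (thetaIndex X).V),
    Set ((logShellsDH X (analyticLogv F)).Packet j ((thetaIndex X).over v)))
  (Ψ : ℤ → ∀ v : (thetaIndex X).V, v ∈ (thetaIndex X).Vbad → Set ((logShellsDH X (analyticLogv F)).StarPacket v))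
  (act : ℤ → ∀ v : (thetaIndex X).V, v ∈ (thetaIndex X).Vbad →
    (logShellsDH X (analyticLogv F)).StarPacket v → Module.End ℚ ((logShellsDH X (analyticLogv F)).StarPacket v))
  (Mmod : ℤ → ∀ j : (thetaIndex X).LabelStar, Set ((logShellsDH X (analyticLogv F)).GlobalPacket j.1))
  (region : ℤ → ∀ j : (thetaIndex X).LabelStar, FinDivisor M → ∀ vQ : (thetaIndex X).VQ,
    Set ((logShellsDH X (analyticLogv F)).Packet j.1 vQ))
  (frobAdm : ℤ → ℤ → ∀ (j : (thetaIndex X).Label) (vQ : (thetaIndex X).VQ),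
    Set ((logShellsDH X (analyticLogv F)).Packet j vQ) → Prop)
  (frobLogvol : ℤ → ℤ → ∀ (j : (thetaIndex X).Label) (vQ : (thetaIndex X).VQ),
    Set ((logShellsDH X (analyticLogv F)).Packet j vQ) → ℝ)
  (frobΨ : ℤ → ℤ → ∀ v : (thetaIndex X).V, v ∈ (thetaIndex X).Vbad → Set ((logShellsDH X (analyticLogv F)).StarPacket v))
  (frobMmod : ℤ → ℤ → ∀ j : (thetaIndex X).LabelStar, Set ((logShellsDH X (analyticLogv F)).GlobalPacket j.1))
  (unitImage : ℤ → ℤ → ℕ → ∀ (j : (thetaIndex X).Label) (vQ : (thetaIndex X).VQ),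
    Set ((logShellsDH X (analyticLogv F)).Packet j vQ))
  (ballImage : ℤ → ℤ → ∀ (j : (thetaIndex X).Label) (vQ : (thetaIndex X).VQ),
    Set ((logShellsDH X (analyticLogv F)).Packet j vQ))
  (thetaDiv : ℤ → ℤ → LgpDivisor M (thetaIndex X).lstar)
  (n : ℤ) {HT : Type} {LogLink : HT → HT → Type} {IsFull : ∀ {s t : HT}, LogLink s t → Prop}
  (lat : LGPGaussianLogThetaLattice LogLink IsFull)
  {Frd : Type} {IsoF : Frd → Frd → Type} {Ob : Frd → Type} {realify : Frd → Frd} {Strip : Type}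
  {IsoS : Strip → Strip → Type} {Mv : ∀ v : (thetaIndex X).V, v ∈ (thetaIndex X).Vbad → Type}
  [∀ v h, Monoid (Mv v h)]
  (sig : GlobalLGPFrobenioidSignature (thetaIndex X).lstar (thetaIndex X).V (· ∈ (thetaIndex X).Vbad)
    Frd IsoF Ob realify Strip IsoS Mv)
  (split : SplittingMonoids Mv) {ObΔ : Type} {N : ∀ v : (thetaIndex X).V, v ∈ (thetaIndex X).Vbad → Type}
  [∀ v h, Monoid (N v h)] (qData : QPilotData ObΔ N)
  (t : ∀ (pp : Nat.Primes) (_ : Fin X.lstar) (x : (thetaIndex X).Fibre (.inr pp)),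
    haveI : Fact (pp : ℕ).Prime := ⟨pp.2⟩; kOf X pp.1 x)
  (tq : ∀ (pp : Nat.Primes) (x : (thetaIndex X).Fibre (.inr pp)), haveI : Fact (pp : ℕ).Prime := ⟨pp.2⟩; kOf X pp.1 x)
  (ρ : (∀ v : (thetaIndex X).V, v ∈ (thetaIndex X).Vbad → Set ((logShellsDH X (analyticLogv F)).StarPacket v)) →
    ∀ (j : (thetaIndex X).Label) (vQ : (thetaIndex X).VQ), Set ((logShellsDH X (analyticLogv F)).Packet j vQ))
  (qK : ∀ v : (thetaIndex X).V, v ∈ (thetaIndex X).Vbad → Set ((logShellsDH X (analyticLogv F)).StarPacket v))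
  (htq0 : ∀ pp x, tq pp x ≠ 0)
  (htq1 : ∀ (pp : Nat.Primes) (x : (thetaIndex X).Fibre (.inr pp)),
    haveI : Fact (pp : ℕ).Prime := ⟨pp.2⟩; placeOf X pp.1 x ∉ X.S → ‖tq pp x‖ = 1)

/-! ## 1. The last per-place feed: wild quadratic dyadic places whose unit-log lattice is not `2𝒪` -/

/-- **A PLACE `v₀ ∣ 2` WITH `(e, f) = (2, 1)` AND `log₂(𝒪_{v₀}^×) ≠ 2𝒪_{v₀}` (bad places allowed): `PinnedRegions` FAILS at
`settingPrVolSharp`** for the analytic logarithms — every `X : PilotData F`, `ρ`, `qK`, column data, `Ψ`, ideles, column.  By abc-iut-w4-d017's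
intrinsic trichotomy (`u₀ = 1 − ϖ`): `‖log₂ u₀‖ = ‖ϖ‖` ⇒ no ball is a `2^k·log₂(𝒪^×)` (p446217's `…_of_forall_ne_anyPrime`); `‖log₂ u₀‖ ≤ ‖ϖ‖³`
⇒ `log₂(𝒪^×) = 𝔪³` and the parity mover moves `𝒪 = 𝔪⁰` (`2 ∤ −3`); `‖log₂ u₀‖ = ‖ϖ‖²` ⇒ `log₂(𝒪^×) = 𝔪² = 2𝒪`, excluded.
[cite: DupuyHilado2025, §4.9] [cite: NeukirchANT1999, Ch. II Prop. (5.5)] [claim: Mochizuki2012, status: disputed] -/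
theorem not_pinnedRegions_settingPrVolSharp_of_wild_quadratic_dyadic_anyPrime (v₀ : HeightOneSpectrum (𝓞 F))
    (hv₀ : (thetaIndex X).over (.inr v₀) = .inr ⟨2, Nat.prime_two⟩) (hv : ((2 : ℕ) : 𝓞 F) ∈ v₀.asIdeal)
    (he : v₀.asIdeal.ramificationIdx ℤ = 2) (hf : v₀.asIdeal.inertiaDeg ℤ = 1)
    (hΛ : haveI : Fact (Nat.Prime 2) := ⟨Nat.prime_two⟩
      logUnits (RescaledCompletion F 2 v₀ hv) ≠ closedBall (0 : RescaledCompletion F 2 v₀ hv) ‖(2 : RescaledCompletion F 2 v₀ hv)‖) :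
    ¬ Cor312Vol.PinnedRegions
      (LatticeSituation.ofShells (logShellsDH X (analyticLogv F)) M archPk archSub
        (summandPiecesPr X (logvAnalytic_analyticLogv (F := F))).Adm
        (summandPiecesPr X (logvAnalytic_analyticLogv (F := F))).logvol Ψ act Mmod region frobAdm frobLogvol frobΨ frobMmod
        unitImage ballImage thetaDiv)
      (settingPrVolSharp X (logvAnalytic_analyticLogv (F := F)) M archPk archSub Ψ act Mmod region n lat sig split qData tq t
        htq0 htq1) ρ qK := by
  haveI : Fact (Nat.Prime 2) := ⟨Nat.prime_two⟩
  have he' : absRamificationIdx 2 (RescaledCompletion F 2 v₀ hv) = 2 :=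
    (absRamificationIdx_rescaledCompletion F 2 v₀ hv).trans he
  have hf' : residueDegree 2 (RescaledCompletion F 2 v₀ hv) = 1 := by
    rw [residueDegree_rescaledCompletion F 2 v₀ hv]; exact hf
  obtain ⟨ϖ, hϖ, -⟩ := exists_isUniformizer_rescaledCompletion F 2 v₀ hv
  have hu₀ : ‖1 - (1 - (ϖ : RescaledCompletion F 2 v₀ hv))‖ = ‖(ϖ : RescaledCompletion F 2 v₀ hv)‖ := by
    rw [sub_sub_cancel]
  have hle := WildQuadraticDyadic.norm_unitLog_le_unif hϖ he' hf' (1 - (ϖ : RescaledCompletion F 2 v₀ hv))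
  rcases hle.lt_or_eq with hlt | heq
  · rcases (WildQuadraticDyadic.norm_le_sq_of_norm_lt_unif hϖ hlt).lt_or_eq with hlt2 | heq2
    · -- `log₂(𝒪^×) = 𝔪³`: the parity mover moves the unit ball `𝔪⁰` (`2 ∤ 0 − 3`)
      have hΛ3 : logUnits (RescaledCompletion F 2 v₀ hv) =
          closedBall (0 : RescaledCompletion F 2 v₀ hv) ‖(ϖ : RescaledCompletion F 2 v₀ hv) ^ (3 : ℤ)‖ := by
        rw [WildQuadraticDyadic.logUnits_eq_closedBall_of_norm_unitLog_le hϖ he' hf' hu₀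
          (WildQuadraticDyadic.norm_le_cube_of_norm_lt_sq hϖ hlt2), zpow_ofNat, norm_pow]
      have hj : ¬ ((v₀.asIdeal.ramificationIdx ℤ : ℕ) : ℤ) ∣ ((0 : ℤ) - 3) := by rw [he]; norm_num
      have hmov := exists_mem_ismDH_image_closedBall_ne_of_logUnits_eq_of_not_dvd (logvAnalyticAt_analyticLogv (F := F) 2) v₀ hv hϖ
        hΛ3 hj
      rw [zpow_zero, norm_one] at hmov
      exact not_pinnedRegions_settingPrVolSharp_of_mover_at X M archPk archSub Ψ act Mmod region frobAdm frobLogvol frobΨ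
          frobMmod unitImage ballImage thetaDiv n lat sig split qData t tq ρ qK htq0 htq1 2 v₀ hv hmov
    · -- `log₂(𝒪^×) = 𝔪² = 2𝒪`: the `ℚ_2(√3)`-type, excluded by `hΛ`
      exfalso
      apply hΛ
      rw [WildQuadraticDyadic.logUnits_eq_closedBall_of_norm_unitLog_eq_sq hϖ he' hf' hu₀ heq2,
        WildQuadraticDyadic.norm_unif_sq_eq_norm_two hϖ he']
  · -- `‖log₂ u₀‖ = ‖ϖ‖`: no ball is a `2^k · log₂(𝒪^×)`
    refine not_pinnedRegions_settingPrVolSharp_of_forall_ne_anyPrime X M archPk archSub Ψ act Mmod region frobAdm frobLogvol frobΨ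
          frobMmod unitImage ballImage thetaDiv n lat sig split qData t tq ρ qK htq0 htq1 ⟨2, Nat.prime_two⟩ v₀ hv₀ hv fun k hk => ?_
    have h := WildQuadraticDyadic.closedBall_ne_zpow_smul_logUnits hϖ he' hf' hu₀ heq (1 : RescaledCompletion F 2 v₀ hv) k
    rw [norm_one] at h
    exact h (by simpa only [Nat.cast_ofNat] using hk)

/-- The same for `PinnedRegions3`. [claim: Mochizuki2012, status: disputed] -/
theorem not_pinnedRegions3_settingPrVolSharp_of_wild_quadratic_dyadic_anyPrime (v₀ : HeightOneSpectrum (𝓞 F))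
    (hv₀ : (thetaIndex X).over (.inr v₀) = .inr ⟨2, Nat.prime_two⟩) (hv : ((2 : ℕ) : 𝓞 F) ∈ v₀.asIdeal)
    (he : v₀.asIdeal.ramificationIdx ℤ = 2) (hf : v₀.asIdeal.inertiaDeg ℤ = 1)
    (hΛ : haveI : Fact (Nat.Prime 2) := ⟨Nat.prime_two⟩
      logUnits (RescaledCompletion F 2 v₀ hv) ≠ closedBall (0 : RescaledCompletion F 2 v₀ hv) ‖(2 : RescaledCompletion F 2 v₀ hv)‖) :
    ¬ Cor312Vol.PinnedRegions3
      (LatticeSituation.ofShells (logShellsDH X (analyticLogv F)) M archPk archSub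
        (summandPiecesPr X (logvAnalytic_analyticLogv (F := F))).Adm
        (summandPiecesPr X (logvAnalytic_analyticLogv (F := F))).logvol Ψ act Mmod region frobAdm frobLogvol frobΨ frobMmod
        unitImage ballImage thetaDiv)
      (settingPrVolSharp X (logvAnalytic_analyticLogv (F := F)) M archPk archSub Ψ act Mmod region n lat sig split qData tq t
        htq0 htq1) ρ qK :=
  fun h => not_pinnedRegions_settingPrVolSharp_of_wild_quadratic_dyadic_anyPrime X M archPk archSub Ψ act Mmod region frobAdm frobLogvol frobΨ
          frobMmod unitImage ballImage thetaDiv n lat sig split qData t tq ρ qK htq0 htq1 v₀ hv₀ hv he hf hΛ h.1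

/-! ## 2. The residual theorem: every `F ≠ ℚ` off the two residual ramified types -/

/-- **THE KERNEL RESIDUAL THEOREM OF ROW Y-26.**  For EVERY number field `F ≠ ℚ` (`1 < [F : ℚ]`): if no place `v ∣ 3` with
`(e, f) = (2, 1)` has `ζ_3` in its completion (`torsionPExp 3 F_v = 0` — the `ℚ_3(ζ_3)`-type excluded) and no place `v ∣ 2` with
`(e, f) = (2, 1)` has `log₂(𝒪_v^×) = 2𝒪_v` (the `ℚ_2(√3)`-type excluded), then **`PinnedRegions` FAILS at `settingPrVolSharp`** for the
analytic logarithms — every `X : PilotData F`, `ρ`, `qK`, column data, `Ψ`, ideles, column.  `F ≠ ℚ` is ramified somewhere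
(Hermite–Minkowski + Dedekind); a ramified place over `p ≥ 5` is abc-iut-E-t44's p446474, over `3` it is p461298's `…_of_three_anyPrime` or
`…_of_torsionPExp_eq_zero_anyPrime`, over `2` it is p461298's `…_of_dyadic_complete_anyPrime` or §1.
[cite: DupuyHilado2025, §4.9] [cite: NeukirchANT1999, Ch. II Prop. (5.5), (5.7), Ch. III Thm. (2.12)] [claim: Mochizuki2012, status: disputed] -/
theorem not_pinnedRegions_settingPrVolSharp_of_one_lt_finrank (hF : 1 < Module.finrank ℚ F)
    (h3 : ∀ (v : HeightOneSpectrum (𝓞 F)) (hv : ((3 : ℕ) : 𝓞 F) ∈ v.asIdeal), v.asIdeal.ramificationIdx ℤ = 2 →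
      v.asIdeal.inertiaDeg ℤ = 1 → haveI : Fact (Nat.Prime 3) := ⟨Nat.prime_three⟩
      torsionPExp 3 (RescaledCompletion F 3 v hv) = 0)
    (h2 : ∀ (v : HeightOneSpectrum (𝓞 F)) (hv : ((2 : ℕ) : 𝓞 F) ∈ v.asIdeal), v.asIdeal.ramificationIdx ℤ = 2 →
      v.asIdeal.inertiaDeg ℤ = 1 → haveI : Fact (Nat.Prime 2) := ⟨Nat.prime_two⟩
      logUnits (RescaledCompletion F 2 v hv) ≠ closedBall (0 : RescaledCompletion F 2 v hv) ‖(2 : RescaledCompletion F 2 v hv)‖) :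
    ¬ Cor312Vol.PinnedRegions
      (LatticeSituation.ofShells (logShellsDH X (analyticLogv F)) M archPk archSub
        (summandPiecesPr X (logvAnalytic_analyticLogv (F := F))).Adm
        (summandPiecesPr X (logvAnalytic_analyticLogv (F := F))).logvol Ψ act Mmod region frobAdm frobLogvol frobΨ frobMmod
        unitImage ballImage thetaDiv)
      (settingPrVolSharp X (logvAnalytic_analyticLogv (F := F)) M archPk archSub Ψ act Mmod region n lat sig split qData tq t
        htq0 htq1) ρ qK := by
  obtain ⟨p, u, hp, hres, he2⟩ := exists_prime_two_le_ramificationIdx_of_one_lt_finrank hF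
  haveI : Fact p.Prime := ⟨hp⟩
  have hu₀ : (thetaIndex X).over (.inr u) = .inr ⟨p, hp⟩ := by
    rw [over_inr_eq]; exact congrArg Sum.inr (Subtype.ext hres)
  have hu : ((p : ℕ) : 𝓞 F) ∈ u.asIdeal := natCast_mem_placeOf X (⟨p, hp⟩ : Nat.Primes) ⟨.inr u, hu₀⟩
  by_cases hp5 : 5 ≤ p
  · exact not_pinnedRegions_settingPrVolSharp_of_ramified_five_le_anyPrime X M archPk archSub Ψ act Mmod region frobAdm frobLogvol frobΨ
          frobMmod unitImage ballImage thetaDiv n lat sig split qData t tq ρ qK htq0 htq1 ⟨p, hp⟩ hp5 u hu₀ he2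
  · have hp23 : p = 2 ∨ p = 3 := by
      have h2 := hp.two_le
      have h4 : p ≠ 4 := fun h => by rw [h] at hp; exact absurd hp (by decide)
      omega
    rcases hp23 with rfl | rfl
    · -- a ramified place over `2`
      by_cases hef : u.asIdeal.ramificationIdx ℤ = 2 ∧ u.asIdeal.inertiaDeg ℤ = 1
      · exact not_pinnedRegions_settingPrVolSharp_of_wild_quadratic_dyadic_anyPrime X M archPk archSub Ψ act Mmod region frobAdm frobLogvol frobΨ
          frobMmod unitImage ballImage thetaDiv n lat sig split qData t tq ρ qK htq0 htq1 u hu₀ hu hef.1 hef.2 (h2 u hu hef.1 hef.2)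
      · exact not_pinnedRegions_settingPrVolSharp_of_dyadic_complete_anyPrime X M archPk archSub Ψ act Mmod region frobAdm frobLogvol frobΨ
          frobMmod unitImage ballImage thetaDiv n lat sig split qData t tq ρ qK htq0 htq1 u hu₀ he2 hef
    · -- a ramified place over `3`
      by_cases hef : u.asIdeal.ramificationIdx ℤ = 2 ∧ u.asIdeal.inertiaDeg ℤ = 1
      · exact not_pinnedRegions_settingPrVolSharp_of_torsionPExp_eq_zero_anyPrime X M archPk archSub Ψ act Mmod region frobAdm frobLogvol frobΨ
          frobMmod unitImage ballImage thetaDiv n lat sig split qData t tq ρ qK htq0 htq1 ⟨3, hp⟩ u hu₀ hu he2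
          (h3 u hu hef.1 hef.2)
      · exact not_pinnedRegions_settingPrVolSharp_of_three_anyPrime X M archPk archSub Ψ act Mmod region frobAdm frobLogvol frobΨ
          frobMmod unitImage ballImage thetaDiv n lat sig split qData t tq ρ qK htq0 htq1 u hu₀ he2 hef

/-- The same for `PinnedRegions3`. [claim: Mochizuki2012, status: disputed] -/
theorem not_pinnedRegions3_settingPrVolSharp_of_one_lt_finrank (hF : 1 < Module.finrank ℚ F)
    (h3 : ∀ (v : HeightOneSpectrum (𝓞 F)) (hv : ((3 : ℕ) : 𝓞 F) ∈ v.asIdeal), v.asIdeal.ramificationIdx ℤ = 2 →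
      v.asIdeal.inertiaDeg ℤ = 1 → haveI : Fact (Nat.Prime 3) := ⟨Nat.prime_three⟩
      torsionPExp 3 (RescaledCompletion F 3 v hv) = 0)
    (h2 : ∀ (v : HeightOneSpectrum (𝓞 F)) (hv : ((2 : ℕ) : 𝓞 F) ∈ v.asIdeal), v.asIdeal.ramificationIdx ℤ = 2 →
      v.asIdeal.inertiaDeg ℤ = 1 → haveI : Fact (Nat.Prime 2) := ⟨Nat.prime_two⟩
      logUnits (RescaledCompletion F 2 v hv) ≠ closedBall (0 : RescaledCompletion F 2 v hv) ‖(2 : RescaledCompletion F 2 v hv)‖) :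
    ¬ Cor312Vol.PinnedRegions3
      (LatticeSituation.ofShells (logShellsDH X (analyticLogv F)) M archPk archSub
        (summandPiecesPr X (logvAnalytic_analyticLogv (F := F))).Adm
        (summandPiecesPr X (logvAnalytic_analyticLogv (F := F))).logvol Ψ act Mmod region frobAdm frobLogvol frobΨ frobMmod
        unitImage ballImage thetaDiv)
      (settingPrVolSharp X (logvAnalytic_analyticLogv (F := F)) M archPk archSub Ψ act Mmod region n lat sig split qData tq t
        htq0 htq1) ρ qK :=
  fun h => not_pinnedRegions_settingPrVolSharp_of_one_lt_finrank X M archPk archSub Ψ act Mmod region frobAdm frobLogvol frobΨ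
          frobMmod unitImage ballImage thetaDiv n lat sig split qData t tq ρ qK htq0 htq1 hF h3 h2 h.1

/-- **The residual theorem in `√−3`-currency**: the exclusion at `3` read as «no ramified quadratic place over `3` has `r² = −3` in its
completion» (⟸ no `ζ_3`: `r = 2ζ_3 + 1`). [cite: DupuyHilado2025, §4.9] [cite: NeukirchANT1999, Ch. II Prop. (5.5), (5.7)]
[claim: Mochizuki2012, status: disputed] -/
theorem not_pinnedRegions_settingPrVolSharp_of_one_lt_finrank' (hF : 1 < Module.finrank ℚ F)
    (h3 : ∀ (v : HeightOneSpectrum (𝓞 F)) (hv : ((3 : ℕ) : 𝓞 F) ∈ v.asIdeal), v.asIdeal.ramificationIdx ℤ = 2 →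
      v.asIdeal.inertiaDeg ℤ = 1 → haveI : Fact (Nat.Prime 3) := ⟨Nat.prime_three⟩
      ∀ r : RescaledCompletion F 3 v hv, r ^ 2 ≠ -3)
    (h2 : ∀ (v : HeightOneSpectrum (𝓞 F)) (hv : ((2 : ℕ) : 𝓞 F) ∈ v.asIdeal), v.asIdeal.ramificationIdx ℤ = 2 →
      v.asIdeal.inertiaDeg ℤ = 1 → haveI : Fact (Nat.Prime 2) := ⟨Nat.prime_two⟩
      logUnits (RescaledCompletion F 2 v hv) ≠ closedBall (0 : RescaledCompletion F 2 v hv) ‖(2 : RescaledCompletion F 2 v hv)‖) :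
    ¬ Cor312Vol.PinnedRegions
      (LatticeSituation.ofShells (logShellsDH X (analyticLogv F)) M archPk archSub
        (summandPiecesPr X (logvAnalytic_analyticLogv (F := F))).Adm
        (summandPiecesPr X (logvAnalytic_analyticLogv (F := F))).logvol Ψ act Mmod region frobAdm frobLogvol frobΨ frobMmod
        unitImage ballImage thetaDiv)
      (settingPrVolSharp X (logvAnalytic_analyticLogv (F := F)) M archPk archSub Ψ act Mmod region n lat sig split qData tq t
        htq0 htq1) ρ qK :=
  not_pinnedRegions_settingPrVolSharp_of_one_lt_finrank X M archPk archSub Ψ act Mmod region frobAdm frobLogvol frobΨ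
          frobMmod unitImage ballImage thetaDiv n lat sig split qData t tq ρ qK htq0 htq1 hF
    (fun v hv he hf => by
      haveI : Fact (Nat.Prime 3) := ⟨Nat.prime_three⟩
      by_contra hm
      obtain ⟨r, hr⟩ := exists_sq_eq_neg_three_of_torsionPExp_ne_zero (RescaledCompletion F 3 v hv) hm
      exact h3 v hv he hf r hr)
    h2

end Summit.ABC.IUTFork.Joshi

end
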